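import Mathlib
import Literature.MathematicalPhysics.QuantumFieldTheory.MirrorRPKernel
import Literature.Analysis.Complex.QuarterStripContinuation
import Literature.Analysis.Complex.StripTilingEntire
import HarnessLib

/-!
# Strip tiling ⇒ entire angular profile of exponential type `β`: stub `stub_stripTilingEntire`
# of line `entire-profile-null-growth` for crux `PrecisionLaplacian.StableConeRPRigidity`
# (stmt-CriticalPhenomena-4800)

Statement (S2 of the line, pure one-variable complex analysis).  Let `κ : ℝ → ℝ` be continuous,
`π`-periodic, and symmetric about the two centres `γⱼ + π/2` (`κ(2γⱼ + π - ω) = κ(ω)`), with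
`γ₂ - γ₁ ∉ (π/2)ℤ`.  Suppose the two oblique traces are boundary values of half-plane
holomorphic functions: `κ(γⱼ + π/2 - θ) = (cos θ)^{-β} Fⱼ(tan θ)` for `θ ∈ (0, π/2)`, where `Fⱼ` is
holomorphic on `{Re t > 0}` with `‖Fⱼ t‖ ≤ C (Re t)^{-β}` (`β ≥ 0`).  Then `κ` is the restriction
to `ℝ` of an entire function `G` with `‖G ω‖ ≤ C' e^{β |Im ω|}`.

Proof.  Three tree theorems of `Literature/Analysis/Complex`:
* `exists_quarterStrip_continuation` — `Φⱼ(θ) = (cos θ)^{-β} Fⱼ(tan θ)` is holomorphic on the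
  quarter strip `0 < Re θ < π/2` (`Re cos θ > 0`, `Re tan θ > 0` there), restricts to the real
  formula, and `‖Φⱼ(a+ib)‖ ≤ C (e^{|b|}/(sin a cos a))^β`;
* `exists_tiled_continuation` — transporting `Φⱼ` by `ω ↦ 2γⱼ + π - ω` and `ω ↦ ω + π` gives
  `Aⱼ`, holomorphic off the lines `Re ω ∈ γⱼ + (π/2)ℤ`, equal to `κ` at the real points off that
  lattice, with `‖Aⱼ ω‖ ≤ C (e^{|Im ω|}/(f(1-f)))^β`, `f` the fractional cell position of `Re ω`;
* `exists_entire_of_two_tilings` — the two line families are disjoint, `A₁ = A₂` on every common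
  vertical strip (identity theorem from the common real values), the glued function is entire,
  equals `κ` on all of `ℝ`, and every abscissa is at fractional distance `≥ δ > 0` from one of
  the lattices, giving `C' = C δ^{-2β}`.
Continuity of `κ` is not used (the lattice points are real points of the other tiling).
-/

noncomputable section

namespace Summit.CriticalPhenomena.Ising3DConformalLimit.Cruxes.StableConeRPRigidity.EntireProfileNullGrowth

open Literature.Analysis.Complex in
/-- **S2 · strip tiling (registered stub `stub_stripTilingEntire`, statement `StripTilingEntire`
verbatim).** A continuous `π`-periodic profile `κ`, symmetric about `γ₁ + π/2` and `γ₂ + π/2`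
with `γ₂ - γ₁ ∉ (π/2)ℤ`, whose two oblique traces `θ ↦ κ(γⱼ + π/2 - θ)` on `(0, π/2)` are
boundary values `(cos θ)^{-β} Fⱼ(tan θ)` of half-plane holomorphic `Fⱼ` with
`‖Fⱼ t‖ ≤ C (Re t)^{-β}`, is the restriction of an ENTIRE function of exponential type `≤ β`.
Proof: `Literature.Analysis.Complex.exists_quarterStrip_continuation` (holomorphy and growth of
`(cos θ)^{-β} Fⱼ(tan θ)` on `0 < Re θ < π/2`), `exists_tiled_continuation` (transport by the two
symmetries of `κ` to all strips between the lines `Re ω ∈ γⱼ + (π/2)ℤ`) and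
`exists_entire_of_two_tilings` (identity theorem on the common strips, piecewise gluing, uniform
distance `δ > 0` of every abscissa from one of the two disjoint lattices). Continuity of `κ` is
not needed. -/
theorem stub_stripTilingEntire :
    ∀ (κ : ℝ → ℝ) (β γ₁ γ₂ C : ℝ) (F₁ F₂ : ℂ → ℂ), 0 ≤ β →
      Continuous κ → (∀ ω, κ (ω + Real.pi) = κ ω) →
      (∀ ω, κ (2 * γ₁ + Real.pi - ω) = κ ω) → (∀ ω, κ (2 * γ₂ + Real.pi - ω) = κ ω) →
      (∀ k : ℤ, γ₂ - γ₁ ≠ (k : ℝ) * (Real.pi / 2)) →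
      DifferentiableOn ℂ F₁ {t : ℂ | 0 < t.re} → DifferentiableOn ℂ F₂ {t : ℂ | 0 < t.re} →
      (∀ t : ℂ, 0 < t.re → ‖F₁ t‖ ≤ C * t.re ^ (-β)) → (∀ t : ℂ, 0 < t.re → ‖F₂ t‖ ≤ C * t.re ^ (-β)) →
      (∀ θ : ℝ, 0 < θ → θ < Real.pi / 2 →
        ((κ (γ₁ + Real.pi / 2 - θ) : ℝ) : ℂ) = ((Real.cos θ ^ (-β) : ℝ) : ℂ) * F₁ ((Real.tan θ : ℝ) : ℂ)) →
      (∀ θ : ℝ, 0 < θ → θ < Real.pi / 2 →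
        ((κ (γ₂ + Real.pi / 2 - θ) : ℝ) : ℂ) = ((Real.cos θ ^ (-β) : ℝ) : ℂ) * F₂ ((Real.tan θ : ℝ) : ℂ)) →
      ∃ G : ℂ → ℂ, Differentiable ℂ G ∧ (∀ ω : ℝ, G ω = ((κ ω : ℝ) : ℂ)) ∧
        ∃ C' : ℝ, ∀ ω : ℂ, ‖G ω‖ ≤ C' * Real.exp (β * |ω.im|) := by
  intro κ β γ₁ γ₂ C F₁ F₂ hβ _hκ hper hs₁ hs₂ hγ hF₁ hF₂ hb₁ hb₂ hθ₁ hθ₂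
  have hC : 0 ≤ C := by
    have := hb₁ 1 (by simp)
    simp only [Complex.one_re, Real.one_rpow, mul_one] at this
    exact (norm_nonneg _).trans this
  obtain ⟨Φ₁, hΦ₁d, hΦ₁r, hΦ₁b⟩ := exists_quarterStrip_continuation hβ hF₁ hb₁
  obtain ⟨Φ₂, hΦ₂d, hΦ₂r, hΦ₂b⟩ := exists_quarterStrip_continuation hβ hF₂ hb₂
  obtain ⟨A₁, hA₁d, hA₁κ, hA₁b⟩ := exists_tiled_continuation (κ := κ) (γ := γ₁) hβ hC hper hs₁
    hΦ₁d (fun θ h1 h2 => by rw [hΦ₁r θ h1 h2, hθ₁ θ h1 h2]) hΦ₁b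
  obtain ⟨A₂, hA₂d, hA₂κ, hA₂b⟩ := exists_tiled_continuation (κ := κ) (γ := γ₂) hβ hC hper hs₂
    hΦ₂d (fun θ h1 h2 => by rw [hΦ₂r θ h1 h2, hθ₂ θ h1 h2]) hΦ₂b
  exact exists_entire_of_two_tilings hβ hC hγ hA₁d hA₁κ hA₁b hA₂d hA₂κ hA₂b

end Summit.CriticalPhenomena.Ising3DConformalLimit.Cruxes.StableConeRPRigidity.EntireProfileNullGrowth
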